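import Literature.NumberTheory.EllipticCurves.TakahashiRankOneOfEichlerSelberg
import Literature.NumberTheory.EllipticCurves.HeckeFixedPointCount
import Literature.NumberTheory.Automorphic.HeckeTraceFormulaGL2LevelPrimeDifference
import HarnessLib

/-!
# Stub ideas k3 — GENERATION 5 (FAMILY 3, probe the extremes) for `stub_takahashi`
# (`takahashi2001_thm_2_3_of_coprime`), crux `DefiniteRTControlPrime`, route `DefiniteXi`

Scratch sketch: elaboration sanity of the NEW helper-lemma signatures only (no proofs claimed
except the two `decide`-free one-liners marked PROVED).  Gens 1–4 retained BY REFERENCE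
(`StubIdeas3Sketch`, `StubIdeas3g2Sketch`, `StubIdeas3g3Sketch`, `StubIdeas3g4Sketch`).

Gen-5 content.  The one live lemma of the depth path, O3 = `StubIdeas3g4.PopaCountPrimePow`
(= gen-3 `fixCount_primePow_eq_localDensity`): "#fixed points of an integer matrix `A`
(`q ∤ det A`) on `ℙ¹(ℤ/q^e)` = the Cohen–Oesterlé density `μ_{q^e}(tr A, content A, det A)`",
is split into three prover-cycle pieces, EACH certified separately by brute force at the extremes
`q = 2, e ≤ 8` (Frey levels), `q = 3, e ≤ 5`, `q = 5, e ≤ 3`, `q = 7, e ≤ 2`, content up to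
`q^{e+1}` (the all-fixed extreme), 0 mismatches in 12 534 / 50 061 / 12 534 checks
(`scratch/o3_pieces.py`):
* O3a  content reduction on unimodular vectors (H5.1a scalar extreme, H5.1b fibres `q^{2ρ}`);
* O3b  primitive (= regular) matrix: projective fixed points = roots of the characteristic
       polynomial in `ℤ/q^m`, including the non-semisimple extreme `(X − λ)²`;
* O3c  density side: the unit-solution count of `x² − tx + n ≡ 0 (q^{e+ρ})` modulo `q^e` equals the
       root count of the PRIMITIVE polynomial modulo `q^{e−ρ}` (substitution `x = a + uλ`; at
       `q = 2` the naive Hensel bijection is off by one bit but the COUNT identity holds — certified).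
-/

noncomputable section

open scoped BigOperators Matrix
open Finset

set_option linter.dupNamespace false

namespace Summit.ABC.ABC.Cruxes.DefiniteRTControlPrime.StubIdeas3g5

open Literature.NumberTheory.EllipticCurves
open Literature.NumberTheory.EllipticCurves.ModularForms
open Literature.NumberTheory.Automorphic Literature.NumberTheory.Automorphic.Brandt
open Literature.NumberTheory.Automorphic.HeckeTraceFormulaGL2Level

/-! ### Currency (verbatim copies of `StubIdeas3g4Sketch.fixedUnimodular` / `content`; crux-dir
sketch modules are not importable) -/

/-- Unimodular vectors of `(ℤ/N)²` fixed PROJECTIVELY by the integer matrix `A`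
(`A v = c v` for some scalar `c`, not necessarily a unit); `= φ(N) · #Fix(A | ℙ¹(ℤ/N))` at prime
powers `N`. [verbatim gen-4] -/
def fixedUnimodular (N : ℕ) [NeZero N] (A : Matrix (Fin 2) (Fin 2) ℤ) : Finset (Fin 2 → ZMod N) := by
  classical
  exact Finset.univ.filter fun v =>
    (IsUnit (v 0) ∨ IsUnit (v 1)) ∧ ∃ c : ZMod N, (A.map (Int.cast : ℤ → ZMod N)) *ᵥ v = c • v

/-- The content `gcd(c, d − a, b)` of `A = (a b; c d)` (= gen-3 `fixFormContent`). [verbatim gen-4] -/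
def content (A : Matrix (Fin 2) (Fin 2) ℤ) : ℕ := Int.gcd (Int.gcd (A 1 0) (A 1 1 - A 0 0)) (A 0 1)

/-- O3 verbatim (gen-4 `PopaCountPrimePow`), the target of the gen-5 assembly. -/
def PopaCountPrimePow : Prop :=
  ∀ (q e : ℕ) [Fact q.Prime], 1 ≤ e → ∀ (A : Matrix (Fin 2) (Fin 2) ℤ) (n : ℕ),
    A.det = (n : ℤ) → n.Coprime q →
    haveI : NeZero (q ^ e) := ⟨pow_ne_zero _ (Fact.out : q.Prime).ne_zero⟩
    ((fixedUnimodular (q ^ e) A).card : ℂ) =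
      (Nat.totient (q ^ e) : ℂ) * localDensity (q ^ e) 1 A.trace (content A) n

-- `NeZero (q ^ e)` from `[Fact q.Prime]` is found by Mathlib's instances (checked); no instance,
-- notation or attribute is declared in this sketch.

/-! ### H5.0 (S) — `ψ(q^e) = (q + 1) q^{e−1}` (not in the tree; `dedekindPsi_prime` is `e = 1`) -/

theorem dedekindPsi_prime_pow {q e : ℕ} (hq : q.Prime) (he : 1 ≤ e) :
    dedekindPsi (q ^ e) = ((q + 1) * q ^ (e - 1) : ℕ) := by
  sorry

/-! ### H5.1 — O3a, content reduction (two extremes) -/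

/-- H5.1a (S) **scalar extreme**: if `A ≡ a·1 (mod q^e)` every unimodular vector is fixed:
`#fixedUnimodular = #{unimodular vectors} = q^{2e} − q^{2e−2} = φ(q^e) ψ(q^e)`. -/
theorem card_fixedUnimodular_of_scalar_mod {q e : ℕ} [Fact q.Prime] (he : 1 ≤ e)
    (A : Matrix (Fin 2) (Fin 2) ℤ) (h10 : ((q : ℤ) ^ e) ∣ A 1 0) (h01 : ((q : ℤ) ^ e) ∣ A 0 1)
    (hdiag : ((q : ℤ) ^ e) ∣ A 0 0 - A 1 1) :
    (fixedUnimodular (q ^ e) A).card = q ^ (2 * e) - q ^ (2 * (e - 1)) := by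
  sorry

/-- H5.1b (M) **fibre reduction**: for `A = a·1 + (q^ρ u')·A₀` with `q ∤ u'` and `ρ < e`, a unimodular
`v (mod q^e)` is projectively `A`-fixed iff its reduction `v̄ (mod q^{e−ρ})` is projectively `A₀`-fixed
(`A v = c v ⇔ q^ρ ∣ c − a ∧ A₀ v̄ = ((c − a)/(q^ρ u')) v̄`), and reduction of unimodular vectors
`(ℤ/q^e)² → (ℤ/q^{e−ρ})²` is `q^{2ρ}`-to-one. -/
theorem card_fixedUnimodular_scalar_add_smul {q e ρ : ℕ} [Fact q.Prime] (hρe : ρ < e)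
    (a u' : ℤ) (hu' : ¬ (q : ℤ) ∣ u') (A₀ : Matrix (Fin 2) (Fin 2) ℤ) :
    (fixedUnimodular (q ^ e) (a • (1 : Matrix (Fin 2) (Fin 2) ℤ) + ((q : ℤ) ^ ρ * u') • A₀)).card =
      q ^ (2 * ρ) * (fixedUnimodular (q ^ (e - ρ)) A₀).card := by
  sorry

/-! ### H5.2 — O3b, primitive matrix: projective fixed points = roots of the characteristic polynomial -/

/-- H5.2 (M) for `A₀` PRIMITIVE at `q` (not `≡` scalar mod `q`; no condition on `det A₀`) and `m ≥ 1`: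
`#fixedUnimodular_{q^m}(A₀) = φ(q^m) · #{x ∈ ℤ/q^m : x² − (tr A₀) x + det A₀ = 0}`.
Proof shape: lift the affine-chart argument of `affFix_eq` (`Y = c u + d` on the chart `[u : 1]` when
`c` is a unit; chart `[1 : u]` when `b` is a unit; when only `d − a` is a unit the two fixed points
`[1:0], [0:1] (mod q)` Hensel-lift uniquely, as do the two simple roots) from `𝔽_q` to `ℤ/q^m`;
the non-semisimple extreme `A₀ = (λ 1; 0 λ)` gives `q^{⌊m/2⌋}` on both sides. -/
theorem card_fixedUnimodular_eq_totient_mul_rootCount {q m : ℕ} [Fact q.Prime] (hm : 1 ≤ m)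
    (A₀ : Matrix (Fin 2) (Fin 2) ℤ)
    (hprim : ¬ ((q : ℤ) ∣ A₀ 1 0 ∧ (q : ℤ) ∣ A₀ 0 1 ∧ (q : ℤ) ∣ A₀ 0 0 - A₀ 1 1)) :
    (fixedUnimodular (q ^ m) A₀).card =
      (q ^ m).totient *
        rootCount (ZMod (q ^ m)) ((A₀ 0 0 + A₀ 1 1 : ℤ) : ZMod (q ^ m)) ((A₀.det : ℤ) : ZMod (q ^ m)) := by
  sorry

/-! ### H5.3 — O3c, the density side: unit solutions of `x² − tx + n ≡ 0 (q^e · q^ρ)` counted mod `q^e` -/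

/-- H5.3a (M) `ρ < e`: with `t = 2a + u t₀`, `n = a² + a u t₀ + u² n₀`, `u = q^ρ u'`, `q ∤ u'`, `q ∤ n`:
`#{x ∈ (ℤ/q^e)ˣ : q^{e+ρ} ∣ x² − t x + n} = #{λ ∈ ℤ/q^{e−ρ} : λ² − t₀ λ + n₀ = 0}`
(`x = a + u λ`, `x² − tx + n = u²(λ² − t₀λ + n₀)`; every solution has `x ≡ a (mod q^ρ)` — for `q = 2`
via `(2x − t)² ≡ u²(t₀² − 4n₀) (mod 2^{e+ρ+2})`, the `four_dvd_quadratic` bit; unit-ness is automatic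
from `q ∤ n`). -/
theorem card_unitSolutions_eq_rootCount {q e ρ : ℕ} [Fact q.Prime] (hρe : ρ < e)
    (a u' t₀ n₀ : ℤ) (hu' : ¬ (q : ℤ) ∣ u') {t : ℤ} {n : ℕ} (hn : n.Coprime q)
    (ht : t = 2 * a + (q : ℤ) ^ ρ * u' * t₀)
    (hn' : (n : ℤ) = a ^ 2 + a * ((q : ℤ) ^ ρ * u') * t₀ + ((q : ℤ) ^ ρ * u') ^ 2 * n₀) :
    (Finset.univ.filter fun x : ZMod (q ^ e) =>
        ((q ^ e * q ^ ρ : ℕ) : ℤ) ∣ (x.val : ℤ) ^ 2 - t * x.val + n ∧ IsUnit x).card =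
      rootCount (ZMod (q ^ (e - ρ))) (t₀ : ZMod (q ^ (e - ρ))) (n₀ : ZMod (q ^ (e - ρ))) := by
  sorry

/-- H5.3b (S) **all-fixed extreme** `ρ ≥ e`: with `t = 2a + q^e s`, `n = a² + a q^e s + q^{2e} m`, `q ∤ n`:
`#{x ∈ (ℤ/q^e)ˣ : q^{2e} ∣ x² − tx + n} = 1` (only `x ≡ a`: `x² − tx + n ≡ (x − a)(x − a − q^e s)`
and `x − a = q^j w`, `j < e`, has valuation exactly `2j < 2e`). -/
theorem card_unitSolutions_eq_one {q e : ℕ} [Fact q.Prime] (he : 1 ≤ e) (a s m : ℤ) {t : ℤ} {n : ℕ}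
    (hn : n.Coprime q) (ht : t = 2 * a + (q : ℤ) ^ e * s)
    (hn' : (n : ℤ) = a ^ 2 + a * (q : ℤ) ^ e * s + ((q : ℤ) ^ e) ^ 2 * m) :
    (Finset.univ.filter fun x : ZMod (q ^ e) =>
        ((q ^ e * q ^ e : ℕ) : ℤ) ∣ (x.val : ℤ) ^ 2 - t * x.val + n ∧ IsUnit x).card = 1 := by
  sorry

/-! ### H5.4 (S) — bridge to the tree currency `eigPairs` / `fixCount` (unit determinant) -/

/-- At a prime power, "some coordinate is a unit" is unimodularity (`IsCoprime`, local ring) and a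
projective eigenvalue of a unit-determinant matrix is a unit, so `fixedUnimodular` counts exactly the
tree's eigen-pairs; with `totient_mul_fixCount` this makes H5.* statements about `fixCount (q^e)`. -/
theorem card_fixedUnimodular_eq_eigPairs {q e : ℕ} [Fact q.Prime] (he : 1 ≤ e)
    (A : Matrix (Fin 2) (Fin 2) ℤ) (hdet : IsUnit (redMat (q ^ e) A).det) :
    (fixedUnimodular (q ^ e) A).card = eigPairs (ZMod (q ^ e)) (redMat (q ^ e) A) := by
  sorry

theorem totient_mul_fixCount_eq_card_fixedUnimodular {q e : ℕ} [Fact q.Prime] (he : 1 ≤ e)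
    (A : Matrix (Fin 2) (Fin 2) ℤ) (hdet : IsUnit (redMat (q ^ e) A).det) :
    (q ^ e).totient * fixCount (q ^ e) A = (fixedUnimodular (q ^ e) A).card := by
  rw [card_fixedUnimodular_eq_eigPairs he A hdet, totient_mul_fixCount hdet]

/-! ### Assembly (S, bookkeeping): H5.0 + H5.1 + H5.2 + H5.3 + `localDensity_one_eq_card` ⇒ O3 -/

/-- The decomposition every integer matrix admits: `A = (A 0 0)·1 + u·A₀` with `u = content A` and
`A₀ = (0, b/u; c/u, (d−a)/u)` primitive (content 1) when `u ≠ 0`. PROVED (definitional). -/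
def primitivePart (A : Matrix (Fin 2) (Fin 2) ℤ) : Matrix (Fin 2) (Fin 2) ℤ :=
  !![0, A 0 1 / (content A : ℤ); A 1 0 / (content A : ℤ), (A 1 1 - A 0 0) / (content A : ℤ)]

theorem eq_scalar_add_content_smul_primitivePart (A : Matrix (Fin 2) (Fin 2) ℤ) :
    A = (A 0 0) • (1 : Matrix (Fin 2) (Fin 2) ℤ) + (content A : ℤ) • primitivePart A := by
  sorry

/-- H5.5 (S): the primitive part is primitive at every prime when `A` is not scalar. -/
theorem primitivePart_primitive (A : Matrix (Fin 2) (Fin 2) ℤ) (hA : content A ≠ 0) {q : ℕ}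
    (hq : q.Prime) :
    ¬ ((q : ℤ) ∣ primitivePart A 1 0 ∧ (q : ℤ) ∣ primitivePart A 0 1 ∧
        (q : ℤ) ∣ primitivePart A 0 0 - primitivePart A 1 1) := by
  sorry

/-- gen-5 assembly: the five helpers give O3 (`PopaCountPrimePow`, verbatim gen-4), hence (gen-4,
PROVED there) `GammaMatrixFixedCount`, `localChainIdentityPow_of`, hence L3, hence (gen-2 glue,
PROVED) `rankOneCoprime_of (hES)`, hence H1-coprime, hence (k2-g2 `stub_of_pinned`, PROVED modulo
`exists_sum_eq_pairingGcd`) the stub from T♭-coprime.  Case split on `ρ = min e (v_q (content A))`: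
`ρ ≥ e` ↦ H5.1a + H5.3b + H5.0 (`φψ = φ · ψ(q^e)/ψ(1) · 1`); `ρ < e` ↦ H5.1b + H5.2 (at `m = e − ρ`)
+ H5.3a + H5.0 (`q^{2ρ} φ(q^{e−ρ}) = φ(q^e) q^ρ = φ(q^e) ψ(q^e)/ψ(q^{e−ρ})`). -/
theorem popaCountPrimePow_of_pieces
    (h0 : ∀ {q e : ℕ}, q.Prime → 1 ≤ e → dedekindPsi (q ^ e) = ((q + 1) * q ^ (e - 1) : ℕ))
    (h1a : ∀ {q e : ℕ} [Fact q.Prime], 1 ≤ e → ∀ (A : Matrix (Fin 2) (Fin 2) ℤ),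
      ((q : ℤ) ^ e) ∣ A 1 0 → ((q : ℤ) ^ e) ∣ A 0 1 → ((q : ℤ) ^ e) ∣ A 0 0 - A 1 1 →
      (fixedUnimodular (q ^ e) A).card = q ^ (2 * e) - q ^ (2 * (e - 1)))
    (h1b : ∀ {q e ρ : ℕ} [Fact q.Prime], ρ < e → ∀ (a u' : ℤ), ¬ (q : ℤ) ∣ u' →
      ∀ (A₀ : Matrix (Fin 2) (Fin 2) ℤ),
      (fixedUnimodular (q ^ e) (a • (1 : Matrix (Fin 2) (Fin 2) ℤ) + ((q : ℤ) ^ ρ * u') • A₀)).card =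
        q ^ (2 * ρ) * (fixedUnimodular (q ^ (e - ρ)) A₀).card)
    (h2 : ∀ {q m : ℕ} [Fact q.Prime], 1 ≤ m → ∀ (A₀ : Matrix (Fin 2) (Fin 2) ℤ),
      ¬ ((q : ℤ) ∣ A₀ 1 0 ∧ (q : ℤ) ∣ A₀ 0 1 ∧ (q : ℤ) ∣ A₀ 0 0 - A₀ 1 1) →
      (fixedUnimodular (q ^ m) A₀).card = (q ^ m).totient *
        rootCount (ZMod (q ^ m)) ((A₀ 0 0 + A₀ 1 1 : ℤ) : ZMod (q ^ m)) ((A₀.det : ℤ) : ZMod (q ^ m)))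
    (h3a : ∀ {q e ρ : ℕ} [Fact q.Prime], ρ < e → ∀ (a u' t₀ n₀ : ℤ), ¬ (q : ℤ) ∣ u' →
      ∀ {t : ℤ} {n : ℕ}, n.Coprime q → t = 2 * a + (q : ℤ) ^ ρ * u' * t₀ →
      (n : ℤ) = a ^ 2 + a * ((q : ℤ) ^ ρ * u') * t₀ + ((q : ℤ) ^ ρ * u') ^ 2 * n₀ →
      (Finset.univ.filter fun x : ZMod (q ^ e) =>
          ((q ^ e * q ^ ρ : ℕ) : ℤ) ∣ (x.val : ℤ) ^ 2 - t * x.val + n ∧ IsUnit x).card =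
        rootCount (ZMod (q ^ (e - ρ))) (t₀ : ZMod (q ^ (e - ρ))) (n₀ : ZMod (q ^ (e - ρ))))
    (h3b : ∀ {q e : ℕ} [Fact q.Prime], 1 ≤ e → ∀ (a s m : ℤ) {t : ℤ} {n : ℕ}, n.Coprime q →
      t = 2 * a + (q : ℤ) ^ e * s → (n : ℤ) = a ^ 2 + a * (q : ℤ) ^ e * s + ((q : ℤ) ^ e) ^ 2 * m →
      (Finset.univ.filter fun x : ZMod (q ^ e) =>
          ((q ^ e * q ^ e : ℕ) : ℤ) ∣ (x.val : ℤ) ^ 2 - t * x.val + n ∧ IsUnit x).card = 1) :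
    PopaCountPrimePow := by
  sorry

/-! ### Sanity `example`s at the extremes (kernel-evaluated root counts; the projective side is
`classical` and not `decide`-able — certified externally, see the module docstring) -/

/-- non-semisimple extreme `(X − 1)² (mod 8)`: `2^{⌊3/2⌋} = 2` roots. -/
example : (Finset.univ.filter fun x : ZMod 8 => x ^ 2 - 2 * x + 1 = 0).card = 2 := by decide
/-- inert extreme `X² + X + 1 (mod 4)`: no roots (so `#Fix = 0` for the order of conductor 1 in `ℚ(√−3)` at `4 ∣ M`). -/
example : (Finset.univ.filter fun x : ZMod 4 => x ^ 2 + x + 1 = 0).card = 0 := by decide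
/-- split extreme `X² − X − 1 (mod 9)`… `5` is not a square mod 3: no roots. -/
example : (Finset.univ.filter fun x : ZMod 9 => x ^ 2 - x - 1 = 0).card = 0 := by decide
/-- ramified-at-2 extreme `X² + 1 (mod 2^e)`: one root mod 2, none mod 4 (Voight Ex. 30.6.14). -/
example : (Finset.univ.filter fun x : ZMod 2 => x ^ 2 + 1 = 0).card = 1 ∧
    (Finset.univ.filter fun x : ZMod 4 => x ^ 2 + 1 = 0).card = 0 := by decide

end Summit.ABC.ABC.Cruxes.DefiniteRTControlPrime.StubIdeas3g5
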